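import Literature.Claims.NS.Dicks2026
import Literature.Analysis.FluidPDE.KNSSMildBootstrapTools
import Literature.Uncategorized.Prop31Charitable

/-!
# C146 `Dicks2026` — REF lane 2 charitable re-typing of Prop 3.1 (ns-claims-ref-2 g7)

CHARITY-I: Proposition 3.1 «Topological Exhaustion» (p.6 l.19–36) re-typed WITH the print's standing
structure on the enstrophy profile — nonnegative (`ℝ≥0∞`-valued, Lemma 3.2), `E(T*) = +∞` (p.8 l.14–17),
and the finite dissipation integral (16) p.6 l.72–77 (locally integrable profile), `0 ≤ T*` — still with
Case 3 read as a finite right limit.  It is STILL FALSE: the profile `t ↦ |t − T*|^{-1/2}` (`+∞` at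
`T*`) is integrable near `T*` (exponent `-1/2 > -1`), nonnegative, finite off `T*`, and tends to `+∞`
from both sides.  Kernel theorem `not_Prop31_charitable`.  Records-grade (the token of the VERDICT is
the typed face `Prop31`, refuted by the author's kit); this file shows the charitable face does not
survive either.

WHAT THIS IS NOT: not a claim about NS regularity or blow-up; not a claim about any author beyond the
typed locator.
-/

open Filter Topology Set MeasureTheory
open scoped ENNReal

set_option linter.dupNamespace false

namespace Summit.NavierStokesRegularity.NavierStokesRegularity.Theorems.Dicks2026Retype

open Literature.Claims.NS.Dicks2026

/-- The real profile `|t − 1|^{-1/2}` written as `(√|t − 1|)⁻¹` (value `0` at `t = 1`). [folklore] -/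
noncomputable def rq (t : ℝ) : ℝ := (Real.sqrt |t - 1|)⁻¹

/-- The witness: `+∞` at `t = 1`, `|t − 1|^{-1/2}` elsewhere. [folklore] -/
noncomputable def W (t : ℝ) : ℝ≥0∞ := if t = 1 then ⊤ else ENNReal.ofReal (rq t)

/-- kit lemma (plumbing) [folklore] -/
theorem W_one : W 1 = ⊤ := by simp [W]

/-- kit lemma (plumbing) [folklore] -/
theorem W_of_ne {t : ℝ} (ht : t ≠ 1) : W t = ENNReal.ofReal (rq t) := by simp [W, ht]

/-- kit lemma (plumbing) [folklore] -/
theorem W_ne_top {t : ℝ} (ht : t ≠ 1) : W t ≠ ⊤ := by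
  rw [W_of_ne ht]; exact ENNReal.ofReal_ne_top

/-- `rq t = |t − 1| ^ (-1/2)`. [folklore] -/
theorem rq_eq_rpow (t : ℝ) : rq t = |t - 1| ^ (-(1 / 2 : ℝ)) := by
  unfold rq
  rw [Real.sqrt_eq_rpow, Real.rpow_neg (abs_nonneg _)]

/-- `√|t − 1| → 0⁺` as `t → 1` within any set avoiding `1`. [folklore] -/
theorem tendsto_sqrt_abs_sub_one {l : Filter ℝ} (hl : l ≤ 𝓝 1) (h1 : ∀ᶠ t in l, t ≠ 1) :
    Tendsto (fun t : ℝ => Real.sqrt |t - 1|) l (𝓝[>] 0) := by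
  refine tendsto_nhdsWithin_of_tendsto_nhds_of_eventually_within _ ?_ ?_
  · have hc : Continuous (fun t : ℝ => Real.sqrt |t - 1|) :=
      Real.continuous_sqrt.comp (continuous_abs.comp (continuous_id.sub continuous_const))
    have := (hc.tendsto 1).mono_left hl
    simpa using this
  · filter_upwards [h1] with t ht
    exact Real.sqrt_pos.mpr (abs_pos.mpr (sub_ne_zero.mpr ht))

/-- kit lemma (plumbing) [folklore] -/
theorem tendsto_rq_left : Tendsto rq (𝓝[<] 1) atTop := by
  unfold rq
  refine tendsto_inv_nhdsGT_zero.comp (tendsto_sqrt_abs_sub_one nhdsWithin_le_nhds ?_)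
  filter_upwards [self_mem_nhdsWithin] with t ht
  exact ne_of_lt (mem_Iio.mp ht)

/-- kit lemma (plumbing) [folklore] -/
theorem tendsto_rq_right : Tendsto rq (𝓝[>] 1) atTop := by
  unfold rq
  refine tendsto_inv_nhdsGT_zero.comp (tendsto_sqrt_abs_sub_one nhdsWithin_le_nhds ?_)
  filter_upwards [self_mem_nhdsWithin] with t ht
  exact ne_of_gt (mem_Ioi.mp ht)

/-- kit lemma (plumbing) [folklore] -/
theorem tendsto_W_left : Tendsto W (𝓝[<] 1) (𝓝 ⊤) := by
  refine (ENNReal.tendsto_ofReal_atTop.comp tendsto_rq_left).congr' ?_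
  filter_upwards [self_mem_nhdsWithin] with t ht
  exact (W_of_ne (ne_of_lt (mem_Iio.mp ht))).symm

/-- kit lemma (plumbing) [folklore] -/
theorem tendsto_W_right : Tendsto W (𝓝[>] 1) (𝓝 ⊤) := by
  refine (ENNReal.tendsto_ofReal_atTop.comp tendsto_rq_right).congr' ?_
  filter_upwards [self_mem_nhdsWithin] with t ht
  exact (W_of_ne (ne_of_gt (mem_Ioi.mp ht))).symm

/-- Transport `→ ⊤` along the coercion `ℝ≥0∞ → EReal`. [folklore] -/
theorem tendsto_coe_ereal_top {l : Filter ℝ} {f : ℝ → ℝ≥0∞} (h : Tendsto f l (𝓝 ⊤)) :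
    Tendsto (fun t => ((f t : ℝ≥0∞) : EReal)) l (𝓝 ⊤) := by
  have h2 := (continuous_coe_ennreal_ereal.tendsto ⊤).comp h
  rw [EReal.coe_ennreal_top] at h2
  exact h2

/-- The witness satisfies the hypothesis «E(T*−) = ∞». [folklore] -/
theorem blowsUpLeft_W : BlowsUpLeft (fun t => (W t : EReal)) 1 :=
  tendsto_coe_ereal_top tendsto_W_left

/-- kit lemma (plumbing) [folklore] -/
theorem tendsto_W_ereal_right : Tendsto (fun t => (W t : EReal)) (𝓝[>] 1) (𝓝 ⊤) :=
  tendsto_coe_ereal_top tendsto_W_right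

/-- kit lemma (plumbing) [folklore] -/
theorem not_case1_W : ¬ Case1 (fun t => (W t : EReal)) 1 := by
  rintro ⟨t, -, ht⟩
  exact not_lt.mpr (EReal.coe_ennreal_nonneg (W t)) ht

/-- kit lemma (plumbing) [folklore] -/
theorem not_case2_W : ¬ Case2 (fun t => (W t : EReal)) 1 := by
  rintro ⟨ε, hε, h⟩
  have h1 := h (1 + ε) ⟨by linarith, le_rfl⟩
  have h2 : W (1 + ε) = ⊤ := EReal.coe_ennreal_eq_top_iff.mp h1
  exact W_ne_top (by linarith) h2

/-- kit lemma (plumbing) [folklore] -/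
theorem not_case3_W : ¬ Case3 (fun t => (W t : EReal)) 1 := by
  rintro ⟨L, hL⟩
  exact EReal.coe_ne_top L (tendsto_nhds_unique hL tendsto_W_ereal_right)

/-- `|t − 1|^{-1/2}` is integrable on `(0, 1]`. [folklore] -/
theorem integrableOn_rq_Ioc_zero_one : IntegrableOn rq (Ioc 0 1) := by
  have h := (intervalIntegrable_iff_integrableOn_Ioc_of_le (by norm_num : (0 : ℝ) ≤ 1)).mp
    (Literature.Analysis.FluidPDE.KNSSBootstrap.intervalIntegrable_rpow_neg_half_sub_right 0 1 1)
  refine h.congr_fun ?_ measurableSet_Ioc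
  intro s hs
  rw [rq_eq_rpow, abs_of_nonpos (by linarith [hs.2] : s - 1 ≤ 0)]
  simp

/-- `|t − 1|^{-1/2}` is integrable on `(1, b]`. [folklore] -/
theorem integrableOn_rq_Ioc_one (b : ℝ) : IntegrableOn rq (Ioc 1 (max 1 b)) := by
  have h := (intervalIntegrable_iff_integrableOn_Ioc_of_le (le_max_left 1 b)).mp
    (Literature.Analysis.FluidPDE.KNSSBootstrap.intervalIntegrable_rpow_neg_half_sub_left 1 (max 1 b) 1)
  refine h.congr_fun ?_ measurableSet_Ioc
  intro s hs
  rw [rq_eq_rpow, abs_of_pos (by linarith [hs.1] : 0 < s - 1)]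

/-- `|t − 1|^{-1/2}` is integrable on every `(0, T)`. [folklore] -/
theorem integrableOn_rq_Ioo (T : ℝ) : IntegrableOn rq (Ioo 0 T) := by
  refine (integrableOn_rq_Ioc_zero_one.union (integrableOn_rq_Ioc_one T)).mono_set ?_
  intro s hs
  rcases le_or_gt s 1 with h | h
  · exact Or.inl ⟨hs.1, h⟩
  · exact Or.inr ⟨h, le_trans hs.2.le (le_max_right 1 T)⟩

/-- The witness agrees a.e. with `ofReal ∘ rq` (they differ only at `t = 1`). [folklore] -/
theorem W_ae_eq : (fun t => W t) =ᵐ[volume] (fun t => ENNReal.ofReal (rq t)) := by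
  rw [Filter.EventuallyEq, ae_iff]
  refine measure_mono_null (fun t ht => ?_) (measure_singleton (1 : ℝ))
  by_contra h1
  exact ht (W_of_ne h1)

/-- The witness has finite dissipation integral on every `(0, T)` — the print's (16). [folklore] -/
theorem lintegral_W_lt_top (T : ℝ) : (∫⁻ s in Ioo 0 T, W s) < ⊤ := by
  rw [lintegral_congr_ae (ae_restrict_of_ae W_ae_eq)]
  exact (integrableOn_rq_Ioo T).lintegral_lt_top

/-- **The charitable face of Prop 3.1 is also false**: the integrable profile `|t − T*|^{-1/2}`
(`+∞` at `T*`) blows up on both sides of `T*`, is nonnegative, and is finite on `(T*, ∞)`.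
[cite: Dicks2026, Prop 3.1 p.6 l.19–36] -/
theorem not_Prop31_charitable : ¬ Literature.Uncategorized.Prop31_charitable := by
  intro h
  rcases h W 1 (by norm_num) W_one (fun T _ => lintegral_W_lt_top T) blowsUpLeft_W with h1 | h2 | h3
  · exact not_case1_W h1
  · exact not_case2_W h2
  · exact not_case3_W h3

/-- Sanity: the charitable face is implied by the typed face (it is a weakening). [folklore] -/
theorem prop31_charitable_of_prop31 (h : Literature.Claims.NS.Dicks2026.Prop31) :
    Literature.Uncategorized.Prop31_charitable := fun E Ts _ _ _ hB => h (fun t => (E t : EReal)) Ts hB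

end Summit.NavierStokesRegularity.NavierStokesRegularity.Theorems.Dicks2026Retype

-- WHAT THIS IS NOT: not a claim about NS regularity or blow-up; not a claim about any author beyond the typed locator.
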